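import Summits.ABC.IUTFork.Repair.CandMochizuki33
import Summits.ABC.IUTFork.ForkSwitch
import HarnessLib

/-!
# F6 instance closers (D-0079 L-F sub-cell F6), IUTFork rows F-1884 and F-1901 — abc-iut-L6-lead RULING 14:06:21Z offer (a)

PROOF-ONLY companion (no `def`, no `structure`, no `instance`; abc-iut-c312-6 gen 12). The cross-reference table of record
(abc-iut-w5-d145 `F6-IUTFORK-XREF.tsv` 5974af28adc2d03a) classes both rows `COND` with the condition `G` INSTANCE-WITNESSED in the
tree and only the composite missing:

* **F-1884** `Cor312Rmk.Itw.FirstArrow` ([IUTchIII] Rmk 3.12.2 (ii) (f^itw), the first «⟹»): `G = ImageOfCitw` is witnessed at the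
  HULL-level instance `Repair.CandMochizuki32.itwHull P j vQ U` for every carrier `U` of every setting (`Repair.CandMochizuki33.imageOfCitw_hull`,
  p431548). Composite landed here: `firstArrow_itwHull_of_thetaItw` — at that instance the first arrow holds for every carrier that IS one
  of the Θ-pilot's Kummer images (`thetaItw`), by c312-8's bookkeeping `Itw.firstArrow_of_imageOfCitw`; the REGION-level twin under the
  Θ-pin + Thm 3.11 (ii)(b) (`firstArrow_itwRegion_of_thetaItw`, via `imageOfCitw_region`); and, for the ONE carrier print cares about
  (`U :=` the q-pilot's region), the exact content `firstArrow_itwHull_qRegion_iff` : first arrow ⟺ `qRegion ⊆ thetaHull` (the packet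
  licence — the disputed inclusion itself; nothing here asserts it).
* **F-1901** `LogThetaModel.NontrivialBound`: `G = ScaledCopies` is PROVED for every `LanaModel` whose diagrams of copies of `ℝ` are
  the ones read off LANA's BPSs (`LanaModel.scaledCopies_of_lanaDiagrams`, ForkSwitch p405407). Composite landed here:
  `LanaModel.nontrivialBound_of_lanaDiagrams` (2-line corollary through `LogThetaModel.nontrivialBound_of_scaledCopies`).
* (**F-1896** `PilotCalibration.BareInside` @ `IndData`, the third closer of the ruling, is already landed:
  `IndData.bareInside_of_bare_eq`, `F6ForkDecisionsInflationVojta.lean` p452252 — not repeated.)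

HONEST FRAMING: each closer is OUR kernel composite of OUR typed predicates at a named instance; a composite whose hypothesis
(`thetaItw` for the q-pilot's own region, i.e. an (AOΘ4)-type identification; LANA's diagrams) is itself a reading says nothing about
print beyond bookkeeping; no side is taken on [IUTchIII] Cor. 3.12; nothing asserts abc proved or refuted; typed ≠ proved.
[claim: Mochizuki2012, status: disputed] [cite: LANA2026Report, §10.2 p. 47, §10.5 p. 49]
-/

noncomputable section

open Set

namespace Summit.ABC.IUTFork

namespace Repair.CandMochizuki33

open Thm311 Cor312 Cor312Vol Cor312Rmk Repair.CandMochizuki32 Literature.IUT.LogThetaLattice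

variable {T : ThetaIndex} (S : LatticeSituation T) (P : Cor312.Setting S.toSituation)
  (ρ : (∀ v : T.V, v ∈ T.Vbad → Set (S.L.StarPacket v)) → ∀ (j : T.Label) (vQ : T.VQ), Set (S.L.Packet j vQ))

/-- **F-1884 @ itwHull (closer).** At the hull-level instance of the (f^itw) frame, for every setting, packet and carrier `U`: if `U` IS
one of the Θ-pilot's Kummer images (`Θ-itw.`), the first «⟹» `(q-itw.) ⟹ (q-itw.) ∧ (Θ-itw./indets.)` HOLDS — composite of the
instance-witnessed `G = ImageOfCitw` (`imageOfCitw_hull`) with c312-8's `Itw.firstArrow_of_imageOfCitw`. No pin, no clause of Thm 3.11.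
[claim: Mochizuki2012, status: disputed] -/
theorem firstArrow_itwHull_of_thetaItw (j : T.Label) (vQ : T.VQ) (U : Set (S.L.Packet j vQ))
    (hΘ : (itwHull P j vQ U).thetaItw) : (itwHull P j vQ U).FirstArrow :=
  (itwHull P j vQ U).firstArrow_of_imageOfCitw hΘ (imageOfCitw_hull S P j vQ U)

/-- **F-1884 @ itwRegion (closer under the Θ-pin).** The REGION-level twin: under the column's Kummer compatibility and the Θ-pin
((Ind3)-collapse, `imageOfCitw_region`), a carrier that is a Kummer image of the Θ-pilot satisfies the first «⟹» at region level.
[claim: Mochizuki2012, status: disputed] -/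
theorem firstArrow_itwRegion_of_thetaItw (hKumB : (S.col P.n).KummerB (S.D P.n)) (hΘpin : ThetaPinned S P ρ)
    (j : T.Label) (vQ : T.VQ) (U : Set (S.L.Packet j vQ)) (hΘ : (itwRegion P j vQ U).thetaItw) :
    (itwRegion P j vQ U).FirstArrow :=
  (itwRegion P j vQ U).firstArrow_of_imageOfCitw hΘ (imageOfCitw_region S P ρ hKumB hΘpin j vQ U)

/-- **F-1884, the one carrier print cares about.** For `U :=` the q-pilot's own region the antecedent `q-itw.` is `rfl`, so at hull level
the first «⟹» is EXACTLY the packet licence `qRegion ⊆ thetaHull` (the inclusion Step (xi) needs; cf. `firstArrow_hull_iff` for the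
∀-carrier form). Recorded as an `iff`; neither side is asserted. [claim: Mochizuki2012, status: disputed] -/
theorem firstArrow_itwHull_qRegion_iff (j : T.Label) (vQ : T.VQ) :
    (itwHull P j vQ (P.qRegion j vQ)).FirstArrow ↔ P.qRegion j vQ ⊆ P.thetaHull j vQ :=
  ⟨fun h => (h rfl).2, fun hsub hq => ⟨hq, hsub⟩⟩

/-- … and at region level it is EXACTLY Reading R3 in the packet, `qRegion ∈ possibleImages`. [claim: Mochizuki2012, status: disputed] -/
theorem firstArrow_itwRegion_qRegion_iff (j : T.Label) (vQ : T.VQ) :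
    (itwRegion P j vQ (P.qRegion j vQ)).FirstArrow ↔ P.qRegion j vQ ∈ P.possibleImages j vQ :=
  ⟨fun h => (h rfl).2, fun hmem hq => ⟨hq, hmem⟩⟩

/-- **F-1884, how the closer meets the licence.** If the q-pilot's region is itself a Kummer image of the Θ-pilot in the packet (an
(AOΘ4)-type identification, `thetaItw` for `U := qRegion`), the packet licence follows at hull level — the single-carrier route of
`H_of_AO4`, read through the closer. [claim: Mochizuki2012, status: disputed] -/
theorem qRegion_subset_thetaHull_of_thetaItw (j : T.Label) (vQ : T.VQ)
    (hΘ : (itwHull P j vQ (P.qRegion j vQ)).thetaItw) : P.qRegion j vQ ⊆ P.thetaHull j vQ :=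
  (firstArrow_itwHull_qRegion_iff S P j vQ).mp (firstArrow_itwHull_of_thetaItw S P j vQ _ hΘ)

end Repair.CandMochizuki33

namespace LanaModel

variable (M : LanaModel)

/-- **F-1901 @ LanaModel (closer).** If the model's diagrams of copies of `ℝ` are the ones read off LANA's BPSs (`LocalDegrees.lanaDiagram`:
route scalar `j²`, natural `q`-side), then — `G = ScaledCopies` being PROVED there (`scaledCopies_of_lanaDiagrams`) — the family-level
`NontrivialBound` holds as soon as the family has a point: the comparison (1.4) read through LANA's diagram is a Diophantine bound
(`LogThetaModel.nontrivialBound_of_scaledCopies`). Whether the proof of Cor. 3.12 factors through this diagram is what the texts dispute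
(LANA §10.2 p. 48 vs Scholze–Stix §2.2); nothing here decides it. [cite: LANA2026Report, §10.2 p. 47] -/
theorem nontrivialBound_of_lanaDiagrams (h : ∀ P, M.diagram P = LocalDegrees.lanaDiagram (M.lstar P)) (P : M.V.Pt) :
    M.NontrivialBound :=
  M.nontrivialBound_of_scaledCopies (M.scaledCopies_of_lanaDiagrams h) P

/-- … and in the same situation the (SS) hypothesis `IdentifiedCopies` fails while the bound holds — the two horns of F-1900/F-1901 at
LANA's diagrams in one line (`not_identifiedCopies_of_lanaDiagrams`). [cite: LANA2026Report, §10.5 p. 49] -/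
theorem nontrivialBound_and_not_identifiedCopies_of_lanaDiagrams
    (h : ∀ P, M.diagram P = LocalDegrees.lanaDiagram (M.lstar P)) (P : M.V.Pt) :
    M.NontrivialBound ∧ ¬ M.IdentifiedCopies :=
  ⟨M.nontrivialBound_of_lanaDiagrams h P, M.not_identifiedCopies_of_lanaDiagrams h P⟩

end LanaModel

end Summit.ABC.IUTFork

end
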